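import Literature.Probability.LatticeModels.VillainCurrentModel
import Mathlib.Topology.Algebra.InfiniteSum.Ring
import Mathlib.Topology.Algebra.InfiniteSum.ENNReal
import Mathlib.Data.ZMod.Basic
import HarnessLib

/-!
# Ginibre's inequality for the Villain model in integer-current variables, and monotonicity of
# the worm two-point function in the graph

For a finite multigraph (vertices `V`, edges `e : ι` from `s e` to `t e`, loops and parallel
edges allowed) with edge stiffnesses `κ_e`, the **Villain current sum** with integer sources
`ρ : V → ℤ` is
`Z(ρ) = ∑_{J : ι → ℤ, div J = ρ} ∏_e e^{-J_e²/(2κ_e)} ∈ ℝ≥0∞`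
(`MultigraphCurrent.currentSum`; `div J (v)` = outflow minus inflow at `v`). By bondwise Fourier
(Poisson) duality `Z(ρ)/Z(0) = ⟨cos(ρ·θ)⟩` for the Villain rotor model on the same graph
(Fröhlich–Spencer 1982 §2; Wallin et al. 1994 §II; in tree for the two-point case:
`villainTwoPoint_eq_currentSum_div`), so Ginibre's second Griffiths inequality for plane rotors
(Ginibre 1970, `⟨cos(ρθ) cos(σθ)⟩ ≥ ⟨cos ρθ⟩⟨cos σθ⟩`) reads, in current language,
`2 Z(ρ) Z(σ) ≤ Z(0) (Z(ρ+σ) + Z(ρ−σ))`,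
and its classical corollary "the two-point function is monotone in the volume" (adding edges can
only increase `Z(δ_x − δ_y)/Z(0)`; Aizenman–Harel–Peled–Shapiro 2021, Cor. 11.4, second half) reads
`Z₀(ρ) Z(0) ≤ Z(ρ) Z₀(0)` for the current sums `Z₀` of any sub-multigraph.

## What is proved here, and how (no duality, no integrals)

Everything is proved DIRECTLY ON THE CURRENT SIDE by a doubling (duplicate-variables) trick that
is special to Gaussian weights:

* `MultigraphCurrent.currentSum_mul_currentSum` — **the doubling identity.** The map
  `(J, J') ↦ (P, Q) = (J + J', J − J')` is a bijection of `ℤ^ι × ℤ^ι` onto the pairs with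
  `P ≡ Q (mod 2)` edgewise; Villain weights separate,
  `e^{-m²/(2κ)} e^{-k²/(2κ)} = e^{-(m+k)²/(4κ)} e^{-(m-k)²/(4κ)}`, and `div` is linear, whence
  `Z(α) Z(β) = ∑_{ε ∈ (ℤ/2)^ι} X_ε(α+β) X_ε(α−β)`, where `X_ε(a)` (`paritySum`) is the current sum
  at stiffness `2κ` restricted to currents of parity `ε` and divergence `a`.
* `MultigraphCurrent.ginibre` — **Ginibre's inequality (GKS-II) in current form**,
  `2 Z(ρ)Z(σ) ≤ Z(0)(Z(ρ+σ) + Z(ρ−σ))`: by the doubling identity this is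
  `2 ∑_ε X_ε(a) X_ε(b) ≤ ∑_ε (X_ε(a)² + X_ε(b)²)`, `a = ρ+σ`, `b = ρ−σ` (AM–GM termwise).
* `MultigraphCurrent.currentSum_sum_elim` — splitting the edge set `ι₀ ⊕ ι₁`:
  `Z(ρ) = ∑_{J₁ ∈ ℤ^{ι₁}} w(J₁) Z_{ι₀}(ρ − div J₁)`.
* `MultigraphCurrent.currentSum_restrict_mul_le` — **sub-multigraph monotonicity**
  `Z_{ι₀}(ρ) Z_{ι₀⊕ι₁}(0) ≤ Z_{ι₀⊕ι₁}(ρ) Z_{ι₀}(0)` (GKS-II applied with `σ = div J₁` and resummed).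
* Bookkeeping lemmas: relabelling edges (`currentSum_comp_equiv`), embedding the vertex set into a
  larger one (`currentSum_comp_embedding`, isolated vertices are harmless), loops carry no
  divergence (`div_eq_zero_of_loop`), `1 ≤ Z(0) < ∞`, `Z(−ρ) = Z(ρ)`.
* The space-time torus model `VillainCurrentModel d L M` of the sibling file is an instance
  (`VillainCurrentModel.currentSum_eq_multigraphCurrentSum`), so it satisfies GKS-II
  (`VillainCurrentModel.two_mul_currentSum_mul_le`), and — the statement requested by route
  AtomisticToContinuum/BoseEinsteinCondensation/BECVortexSheetPeierls (item `SliceMonotonicity`) —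
  the equal-time two-point function of `P` dominates that of any of its **time slices**
  `P.slice τ : VillainCurrentModel d L 1` (the `d`-dimensional Villain model made of the spatial
  bonds of slice `τ`, whose temporal bonds are loops): `VillainCurrentModel.twoPoint_slice_le`.

## Design choices and flags

* `ℝ≥0∞`-valued sums throughout (as in `VillainCurrentModel`): no summability side conditions;
  the doubling identity and GKS-II hold for every real stiffness field (for `κ_e ≤ 0` both sides may
  be `∞`, and Lean's `x/0 = 0` makes `κ_e = 0` the weight-`1` case), positivity `κ_e > 0` is only
  needed for `Z < ∞`.
* The sub-multigraph is presented as `ι₀` inside `ι₀ ⊕ ι₁` (`Sum.elim` of the end-point and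
  stiffness maps); arbitrary decidable edge predicates reduce to this by `Equiv.sumCompl` and
  `currentSum_comp_equiv` (done in the proof of `twoPoint_slice_le`).
* NOT here: the rotor-side statements (combine with `villainTwoPoint_eq_currentSum_div`); GKS-II
  for general (non-Gaussian) dual-positive current weights, for which the doubling trick is not
  available; infinite graphs.
* Search (2026-08-16): Mathlib has no current models and no Griffiths/Ginibre inequalities; the tree
  has Ginibre's inequality for `XY`-type weights on compact abelian groups (`GinibreInequality.lean`),
  the rotor-side Villain monotonicity in the stiffness (`VillainMonotonicityProofs.lean`, AHPS Cor.
  11.4 first half) and the duality (`VillainWormRepresentation.lean`); nothing is redefined here.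

## References

* [Ginibre1970] J. Ginibre, *General formulation of Griffiths' inequalities*, Comm. Math. Phys. 16
  (1970) 310–328 (main theorem; Example (plane rotators)).
* [AizenmanHarelPeledShapiro2021] M. Aizenman, M. Harel, R. Peled, J. Shapiro, arXiv:2110.09498,
  §11.3 Cor. 11.4 ("pointwise monotone in the coupling constants along each edge, and hence in the
  volume of the system").
* [FrohlichSpencerCMP1982] J. Fröhlich, T. Spencer, Comm. Math. Phys. 83 (1982) 411–454, §2.
* [WallinEtAl1994] M. Wallin, E. S. Sørensen, S. M. Girvin, A. P. Young, Phys. Rev. B 49 (1994)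
  12115–12139, §II.
-/

noncomputable section

open Finset Function
open scoped ENNReal

namespace Literature.Probability.LatticeModels

open PositiveCurrentModel

/-! ### An `ℝ≥0∞` arithmetic–geometric mean inequality and a ratio comparison -/

/-- `2ab ≤ a² + b²` in `ℝ≥0∞`. [folklore] -/
theorem ennreal_two_mul_mul_le_add_mul_self (a b : ℝ≥0∞) : 2 * (a * b) ≤ a * a + b * b := by
  rcases eq_or_ne a ∞ with rfl | ha
  · have : (∞ : ℝ≥0∞) * ∞ + b * b = ∞ := by simp
    rw [this]
    exact le_top
  rcases eq_or_ne b ∞ with rfl | hb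
  · have : a * a + (∞ : ℝ≥0∞) * ∞ = ∞ := by simp
    rw [this]
    exact le_top
  lift a to NNReal using ha
  lift b to NNReal using hb
  have h : (2 : NNReal) * (a * b) ≤ a * a + b * b := by
    have := two_mul_le_add_sq a b
    simpa only [sq, mul_assoc] using this
  exact_mod_cast h

/-- Cross-multiplication gives a comparison of ratios in `ℝ≥0∞`: if `a d ≤ c b` with
`b, d ∈ (0, ∞)` then `a / b ≤ c / d`. [folklore] -/
theorem ennreal_div_le_div_of_mul_le_mul {a b c d : ℝ≥0∞} (h : a * d ≤ c * b) (hb0 : b ≠ 0)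
    (hbt : b ≠ ∞) (hd0 : d ≠ 0) (hdt : d ≠ ∞) : a / b ≤ c / d := by
  rw [ENNReal.div_le_iff_le_mul (Or.inl hb0) (Or.inl hbt), div_eq_mul_inv, mul_right_comm,
    ← div_eq_mul_inv, ENNReal.le_div_iff_mul_le (Or.inl hd0) (Or.inl hdt)]
  exact h

/-- The product of two `ℝ≥0∞`-valued series is the double series of the products (no
summability conditions in `ℝ≥0∞`; multiplication is not continuous there, so this is not an
instance of `Summable.tsum_mul_tsum`). [folklore] -/
theorem ennreal_tsum_mul_tsum_eq_tsum_prod {α β : Type*} (f : α → ℝ≥0∞) (g : β → ℝ≥0∞) :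
    (∑' a, f a) * (∑' b, g b) = ∑' p : α × β, f p.1 * g p.2 := by
  rw [ENNReal.tsum_prod (f := fun a b => f a * g b), ← ENNReal.tsum_mul_right]
  refine tsum_congr fun a => ?_
  rw [← ENNReal.tsum_mul_left]

/-! ### Integer currents on a finite multigraph: divergence, Villain weight, current sums -/

namespace MultigraphCurrent

section Parity

variable {ι : Type*}

/-- The edgewise parity `(J_e mod 2)_e ∈ (ℤ/2)^ι` of a current. [folklore] -/
def parity (P : ι → ℤ) : ι → ZMod 2 := fun e => (P e : ZMod 2)

/-- `J + J'` and `J - J'` have the same parity. [folklore] -/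
theorem parity_add_eq_parity_sub (J J' : ι → ℤ) : parity (J + J') = parity (J - J') := by
  funext e
  show ((J e + J' e : ℤ) : ZMod 2) = ((J e - J' e : ℤ) : ZMod 2)
  push_cast
  rw [sub_eq_add_neg, ZMod.neg_eq_self_mod_two]

/-- The **doubling map** `(J, J') ↦ (J + J', J − J')` on pairs of currents. [folklore] -/
def double (p : (ι → ℤ) × (ι → ℤ)) : (ι → ℤ) × (ι → ℤ) := (p.1 + p.2, p.1 - p.2)

/-- The doubling map is injective. [folklore] -/
theorem double_injective : Injective (double : (ι → ℤ) × (ι → ℤ) → (ι → ℤ) × (ι → ℤ)) := by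
  rintro ⟨J₁, J₁'⟩ ⟨J₂, J₂'⟩ h
  simp only [double, Prod.mk.injEq] at h
  obtain ⟨ha, hb⟩ := h
  have e1 : ∀ e, J₁ e + J₁' e = J₂ e + J₂' e := fun e => by simpa using congrFun ha e
  have e2 : ∀ e, J₁ e - J₁' e = J₂ e - J₂' e := fun e => by simpa using congrFun hb e
  refine Prod.ext (funext fun e => ?_) (funext fun e => ?_) <;> linarith [e1 e, e2 e]

/-- The image of the doubling map is the set of pairs of equal parity. [folklore] -/
theorem mem_range_double {P Q : ι → ℤ} (h : parity P = parity Q) :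
    (P, Q) ∈ Set.range (double : (ι → ℤ) × (ι → ℤ) → (ι → ℤ) × (ι → ℤ)) := by
  have hd : ∀ e, (2 : ℤ) ∣ Q e - P e := fun e =>
    (ZMod.intCast_eq_intCast_iff_dvd_sub (P e) (Q e) 2).1 (congrFun h e)
  choose c hc using hd
  refine ⟨(fun e => P e + c e, fun e => -c e), Prod.ext (funext fun e => ?_) (funext fun e => ?_)⟩
  · simp [double]
  · simp only [double, Pi.sub_apply]
    linarith [hc e]

end Parity

variable {V ι : Type*} [DecidableEq V] [Fintype ι]

/-- The **divergence** (outflow minus inflow) of an integer current `J : ι → ℤ` on a finite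
multigraph with edges `e : ι` oriented from `s e` to `t e`:
`div J (v) = ∑_e ([s e = v] − [t e = v]) J_e` (a loop `s e = t e` contributes nothing).
[folklore] -/
def div (s t : ι → V) (J : ι → ℤ) (v : V) : ℤ :=
  ∑ e, ((if s e = v then (1 : ℤ) else 0) - (if t e = v then 1 else 0)) * J e

section Div

variable (s t : ι → V)

/-- The zero current is divergence free. [folklore] -/
@[simp] theorem div_zero : div s t 0 = 0 := by
  funext v
  simp [div]

/-- `div` is additive. [folklore] -/
theorem div_add (J J' : ι → ℤ) : div s t (J + J') = div s t J + div s t J' := by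
  funext v
  simp only [div, Pi.add_apply, mul_add, Finset.sum_add_distrib]

/-- `div (-J) = -div J`. [folklore] -/
theorem div_neg (J : ι → ℤ) : div s t (-J) = -div s t J := by
  funext v
  simp only [div, Pi.neg_apply, mul_neg, Finset.sum_neg_distrib]

/-- `div (J - J') = div J - div J'`. [folklore] -/
theorem div_sub (J J' : ι → ℤ) : div s t (J - J') = div s t J - div s t J' := by
  rw [sub_eq_add_neg, div_add, div_neg, ← sub_eq_add_neg]

/-- A multigraph all of whose edges are loops carries no divergence. [folklore] -/
theorem div_eq_zero_of_loop (h : ∀ e, s e = t e) (J : ι → ℤ) : div s t J = 0 := by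
  funext v
  simp [div, h]

/-- Relabelling the edges along an equivalence does not change the divergence. [folklore] -/
theorem div_comp_equiv {ι' : Type*} [Fintype ι'] (e : ι' ≃ ι) (J : ι → ℤ) :
    div (s ∘ e) (t ∘ e) (J ∘ e) = div s t J := by
  funext v
  simp only [div, Function.comp_apply]
  exact e.sum_comp (fun i => ((if s i = v then (1 : ℤ) else 0) - (if t i = v then 1 else 0)) * J i)

end Div

/-- The divergence on a disjoint union of two edge sets is the sum of the two divergences.
[folklore] -/
theorem div_sum_elim {ι₀ ι₁ : Type*} [Fintype ι₀] [Fintype ι₁] (s₀ t₀ : ι₀ → V)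
    (s₁ t₁ : ι₁ → V) (J₀ : ι₀ → ℤ) (J₁ : ι₁ → ℤ) :
    div (Sum.elim s₀ s₁) (Sum.elim t₀ t₁) (Sum.elim J₀ J₁) = div s₀ t₀ J₀ + div s₁ t₁ J₁ := by
  funext v
  unfold div
  rw [Fintype.sum_sum_type]
  rfl

/-- Embedding the vertex set injectively into a larger one: at the image of a vertex the
divergence is unchanged. [folklore] -/
theorem div_comp_apply {V₀ : Type*} [DecidableEq V₀] (φ : V₀ → V)
    (hφ : Injective φ) (s t : ι → V₀) (J : ι → ℤ) (v : V₀) :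
    div (φ ∘ s) (φ ∘ t) J (φ v) = div s t J v := by
  simp only [div, Function.comp_apply, hφ.eq_iff]

/-- Embedding the vertex set into a larger one: off the image (isolated vertices) the divergence
vanishes. [folklore] -/
theorem div_comp_eq_zero {V₀ : Type*} [DecidableEq V₀] (φ : V₀ → V)
    (s t : ι → V₀) (J : ι → ℤ) {w : V} (hw : w ∉ Set.range φ) : div (φ ∘ s) (φ ∘ t) J w = 0 := by
  refine Finset.sum_eq_zero fun e _ => ?_
  have hs : φ (s e) ≠ w := fun h => hw ⟨s e, h⟩
  have ht : φ (t e) ≠ w := fun h => hw ⟨t e, h⟩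
  simp [hs, ht]

/-- The **Villain weight** of a current, `W_κ(J) = ∏_e e^{-J_e²/(2κ_e)} ∈ ℝ≥0∞`
(Wallin et al. 1994 §II, with one stiffness per edge). [cite: WallinEtAl1994, §II] -/
def weight (κ : ι → ℝ) (J : ι → ℤ) : ℝ≥0∞ :=
  ∏ e, ENNReal.ofReal (villainCurrentWeight (κ e) (J e))

/-- The empty current has weight `1`. [folklore] -/
@[simp] theorem weight_zero (κ : ι → ℝ) : weight κ (0 : ι → ℤ) = 1 := by
  simp [weight]

/-- `W(-J) = W(J)`. [folklore] -/
@[simp] theorem weight_neg (κ : ι → ℝ) (J : ι → ℤ) : weight κ (-J) = weight κ J := by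
  simp only [weight, Pi.neg_apply, villainCurrentWeight_neg]

/-- `W(J) < ∞`. [folklore] -/
theorem weight_ne_top (κ : ι → ℝ) (J : ι → ℤ) : weight κ J ≠ ∞ :=
  ENNReal.prod_ne_top fun _ _ => ENNReal.ofReal_ne_top

/-- Relabelling the edges does not change the weight. [folklore] -/
theorem weight_comp_equiv {ι' : Type*} [Fintype ι'] (e : ι' ≃ ι) (κ : ι → ℝ) (J : ι → ℤ) :
    weight (κ ∘ e) (J ∘ e) = weight κ J := by
  simp only [weight, Function.comp_apply]
  exact e.prod_comp (fun i => ENNReal.ofReal (villainCurrentWeight (κ i) (J i)))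

/-- The weight on a disjoint union of edge sets is the product. [folklore] -/
theorem weight_sum_elim {ι₀ ι₁ : Type*} [Fintype ι₀] [Fintype ι₁] (κ₀ : ι₀ → ℝ) (κ₁ : ι₁ → ℝ)
    (J₀ : ι₀ → ℤ) (J₁ : ι₁ → ℤ) :
    weight (Sum.elim κ₀ κ₁) (Sum.elim J₀ J₁) = weight κ₀ J₀ * weight κ₁ J₁ := by
  simp only [weight, Fintype.prod_sum_type, Sum.elim_inl, Sum.elim_inr]

/-- `∑_{J ∈ ℤ^ι} W_κ(J) < ∞` for positive stiffnesses (product of summable Gaussian factors).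
[folklore] -/
theorem tsum_weight_ne_top [DecidableEq ι] {κ : ι → ℝ} (hκ : ∀ e, 0 < κ e) :
    ∑' J : ι → ℤ, weight κ J ≠ ∞ := by
  have hs : Summable fun J : ι → ℤ => ∏ e, villainCurrentWeight (κ e) (J e) :=
    summable_pi_prod_of_summable' (fun e => villainCurrentWeight (κ e))
      (fun e n => (villainCurrentWeight_pos _ n).le) fun e => summable_villainCurrentWeight (hκ e)
  have hw : ∀ J : ι → ℤ, weight κ J = ENNReal.ofReal (∏ e, villainCurrentWeight (κ e) (J e)) :=
    fun J => (ENNReal.ofReal_prod_of_nonneg fun e _ => (villainCurrentWeight_pos _ _).le).symm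
  simp_rw [hw]
  rw [← ENNReal.ofReal_tsum_of_nonneg
    (fun J => Finset.prod_nonneg fun e _ => (villainCurrentWeight_pos _ _).le) hs]
  exact ENNReal.ofReal_ne_top

/-- **The Gaussian doubling identity on one bond**:
`e^{-m²/(2β)} e^{-k²/(2β)} = e^{-(m+k)²/(4β)} e^{-(m−k)²/(4β)}` (`2m² + 2k² = (m+k)² + (m−k)²`;
for `β = 0` both sides are `1` by Lean's `x/0 = 0`). [folklore] -/
theorem villainCurrentWeight_mul_villainCurrentWeight (β : ℝ) (m k : ℤ) :
    villainCurrentWeight β m * villainCurrentWeight β k =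
      villainCurrentWeight (2 * β) (m + k) * villainCurrentWeight (2 * β) (m - k) := by
  simp only [villainCurrentWeight, ← Real.exp_add]
  congr 1
  push_cast
  rcases eq_or_ne β 0 with rfl | hβ
  · simp
  · field_simp
    ring

/-- The doubling identity for whole configurations:
`W_κ(J) W_κ(J') = W_{2κ}(J + J') W_{2κ}(J − J')`. [folklore] -/
theorem weight_mul_weight (κ : ι → ℝ) (J J' : ι → ℤ) :
    weight κ J * weight κ J' =
      weight (fun e => 2 * κ e) (J + J') * weight (fun e => 2 * κ e) (J - J') := by
  simp only [weight, ← Finset.prod_mul_distrib, Pi.add_apply, Pi.sub_apply]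
  refine Finset.prod_congr rfl fun e _ => ?_
  rw [← ENNReal.ofReal_mul (villainCurrentWeight_pos _ _).le,
    ← ENNReal.ofReal_mul (villainCurrentWeight_pos _ _).le,
    villainCurrentWeight_mul_villainCurrentWeight]

/-- The **Villain current sum with prescribed sources** `ρ` on a finite multigraph:
`Z_κ(ρ) = ∑_{J : div J = ρ} ∏_e e^{-J_e²/(2κ_e)} ∈ ℝ≥0∞` (the `tsum` over all `J : ι → ℤ` of the
indicator times the weight; Wallin et al. 1994 §II "the prime indicates the constraint that `J`
be everywhere divergenceless", here with a general right-hand side and one stiffness per edge;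
Fröhlich–Spencer 1982 §2 for the Villain weights). `ρ = δ_x − δ_y` is the open worm from `x` to
`y`; `Z(δ_x − δ_y)/Z(0)` is the rotor two-point function `⟨cos(θ_x − θ_y)⟩`
(`villainTwoPoint_eq_currentSum_div`). [cite: WallinEtAl1994, §II] -/
def currentSum [Fintype V] (s t : ι → V) (κ : ι → ℝ) (ρ : V → ℤ) : ℝ≥0∞ :=
  ∑' J : ι → ℤ, if div s t J = ρ then weight κ J else 0

variable [Fintype V]

section Basic

variable (s t : ι → V) (κ : ι → ℝ)

/-- `1 ≤ Z(0)`: the empty current. [folklore] -/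
theorem one_le_currentSum_zero : 1 ≤ currentSum s t κ 0 := by
  refine le_trans ?_ (ENNReal.le_tsum (0 : ι → ℤ))
  simp

/-- `Z(0) ≠ 0`. [folklore] -/
theorem currentSum_zero_ne_zero : currentSum s t κ 0 ≠ 0 :=
  (lt_of_lt_of_le one_pos (one_le_currentSum_zero s t κ)).ne'

/-- `Z(ρ) ≤ ∑_J W(J)`. [folklore] -/
theorem currentSum_le_tsum_weight (ρ : V → ℤ) : currentSum s t κ ρ ≤ ∑' J, weight κ J :=
  ENNReal.tsum_le_tsum fun J => by
    split_ifs
    · exact le_rfl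
    · exact bot_le

/-- `Z(ρ) < ∞` for positive stiffnesses. [folklore] -/
theorem currentSum_ne_top [DecidableEq ι] (hκ : ∀ e, 0 < κ e) (ρ : V → ℤ) :
    currentSum s t κ ρ ≠ ∞ :=
  ne_top_of_le_ne_top (tsum_weight_ne_top hκ) (currentSum_le_tsum_weight s t κ ρ)

/-- `Z(-ρ) = Z(ρ)` (substitute `J ↦ -J`). [folklore] -/
theorem currentSum_neg (ρ : V → ℤ) : currentSum s t κ (-ρ) = currentSum s t κ ρ := by
  unfold currentSum
  conv_lhs => rw [← (Equiv.neg (ι → ℤ)).tsum_eq]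
  refine tsum_congr fun J => ?_
  simp only [Equiv.neg_apply, div_neg, neg_inj, weight_neg]

/-- Relabelling the edges along an equivalence does not change any current sum. [folklore] -/
theorem currentSum_comp_equiv {ι' : Type*} [Fintype ι'] (e : ι' ≃ ι) (ρ : V → ℤ) :
    currentSum (s ∘ e) (t ∘ e) (κ ∘ e) ρ = currentSum s t κ ρ := by
  unfold currentSum
  let φ : (ι → ℤ) ≃ (ι' → ℤ) :=
    { toFun := fun J => J ∘ e
      invFun := fun J' => J' ∘ e.symm
      left_inv := fun J => by funext i; simp
      right_inv := fun J' => by funext i; simp }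
  rw [← φ.tsum_eq]
  refine tsum_congr fun J => ?_
  have h1 : div (s ∘ e) (t ∘ e) (φ J) = div s t J := div_comp_equiv s t e J
  have h2 : weight (κ ∘ e) (φ J) = weight κ J := weight_comp_equiv e κ J
  rw [h2]
  exact if_congr (by rw [h1]) rfl rfl

end Basic

/-- **Splitting the edge set.** On a disjoint union `ι₀ ⊕ ι₁` of edge sets, summing first over the
currents on `ι₁`: `Z_{ι₀ ⊕ ι₁}(ρ) = ∑_{J₁ ∈ ℤ^{ι₁}} W(J₁) · Z_{ι₀}(ρ − div J₁)`. [folklore] -/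
theorem currentSum_sum_elim {ι₀ ι₁ : Type*} [Fintype ι₀] [Fintype ι₁] (s₀ t₀ : ι₀ → V)
    (κ₀ : ι₀ → ℝ) (s₁ t₁ : ι₁ → V) (κ₁ : ι₁ → ℝ) (ρ : V → ℤ) :
    currentSum (Sum.elim s₀ s₁) (Sum.elim t₀ t₁) (Sum.elim κ₀ κ₁) ρ =
      ∑' J₁ : ι₁ → ℤ, weight κ₁ J₁ * currentSum s₀ t₀ κ₀ (ρ - div s₁ t₁ J₁) := by
  unfold currentSum
  rw [← (Equiv.sumArrowEquivProdArrow ι₀ ι₁ ℤ).symm.tsum_eq, ENNReal.tsum_prod', ENNReal.tsum_comm]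
  refine tsum_congr fun J₁ => ?_
  rw [← ENNReal.tsum_mul_left]
  refine tsum_congr fun J₀ => ?_
  have h1 : (Equiv.sumArrowEquivProdArrow ι₀ ι₁ ℤ).symm (J₀, J₁) = Sum.elim J₀ J₁ := rfl
  rw [h1, div_sum_elim, weight_sum_elim]
  by_cases h : div s₀ t₀ J₀ = ρ - div s₁ t₁ J₁
  · rw [if_pos h, if_pos (by rw [h, sub_add_cancel]), mul_comm]
  · rw [if_neg h, if_neg (fun h' => h (eq_sub_of_add_eq h')), mul_zero]

/-- **Embedding the vertex set.** If `φ : V₀ → V` is injective, the current sums of the graph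
`(V₀, ι, s, t)` and of the same edges viewed in `V` (`(V, ι, φ ∘ s, φ ∘ t)`, the other vertices being
isolated) agree, for source functions that correspond under `φ` and vanish off its image.
[folklore] -/
theorem currentSum_comp_embedding {V₀ : Type*} [Fintype V₀] [DecidableEq V₀] (φ : V₀ → V)
    (hφ : Injective φ) (s t : ι → V₀) (κ : ι → ℝ) {ρ₀ : V₀ → ℤ} {ρ : V → ℤ}
    (h1 : ∀ v, ρ (φ v) = ρ₀ v) (h2 : ∀ w, w ∉ Set.range φ → ρ w = 0) :
    currentSum (φ ∘ s) (φ ∘ t) κ ρ = currentSum s t κ ρ₀ := by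
  unfold currentSum
  refine tsum_congr fun J => if_congr ?_ rfl rfl
  constructor
  · intro h
    funext v
    rw [← h1 v, ← h, div_comp_apply φ hφ]
  · intro h
    funext w
    by_cases hw : w ∈ Set.range φ
    · obtain ⟨v, rfl⟩ := hw
      rw [div_comp_apply φ hφ, h, h1]
    · rw [div_comp_eq_zero φ s t J hw, h2 w hw]

/-! ### The doubling identity and Ginibre's inequality -/

section Doubling

variable (s t : ι → V) (κ : ι → ℝ)

/-- The **parity-class current sum** `X_ε(a) = ∑_{P ≡ ε (mod 2), div P = a} ∏_e e^{-P_e²/(4κ_e)}`: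
the current sum at DOUBLED stiffness `2κ` restricted to currents of edgewise parity `ε`.
[folklore] -/
def paritySum (ε : ι → ZMod 2) (a : V → ℤ) : ℝ≥0∞ :=
  ∑' P : ι → ℤ, if parity P = ε ∧ div s t P = a then weight (fun e => 2 * κ e) P else 0

variable [DecidableEq ι]

/-- **The doubling identity.** For all source functions `α, β`,
`Z_κ(α) Z_κ(β) = ∑_{ε ∈ (ℤ/2)^ι} X_ε(α + β) X_ε(α − β)`: substitute `(P, Q) = (J + J', J − J')`
in the double sum (a bijection onto the pairs of equal parity, `double_injective`,
`mem_range_double`), use the Gaussian identity `W_κ(J)W_κ(J') = W_{2κ}(P)W_{2κ}(Q)`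
(`weight_mul_weight`) and linearity of `div`, and sort the pairs by their common parity `ε`.
[folklore] -/
theorem currentSum_mul_currentSum (α β : V → ℤ) :
    currentSum s t κ α * currentSum s t κ β =
      ∑ ε : ι → ZMod 2, paritySum s t κ ε (α + β) * paritySum s t κ ε (α - β) := by
  set A : (ι → ZMod 2) → (ι → ℤ) → ℝ≥0∞ := fun ε P =>
    if parity P = ε ∧ div s t P = α + β then weight (fun e => 2 * κ e) P else 0 with hA
  set B : (ι → ZMod 2) → (ι → ℤ) → ℝ≥0∞ := fun ε Q =>
    if parity Q = ε ∧ div s t Q = α - β then weight (fun e => 2 * κ e) Q else 0 with hB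
  -- termwise form of the substitution
  have hF : ∀ J J' : ι → ℤ,
      (if div s t J = α then weight κ J else 0) * (if div s t J' = β then weight κ J' else 0) =
        ∑ ε, A ε (J + J') * B ε (J - J') := by
    intro J J'
    rw [Finset.sum_eq_single (parity (J + J'))]
    · simp only [hA, hB, ← parity_add_eq_parity_sub J J', true_and, ite_zero_mul_ite_zero]
      refine if_congr ?_ (weight_mul_weight κ J J') rfl
      constructor
      · rintro ⟨h1, h2⟩
        rw [div_add, div_sub, h1, h2]
        exact ⟨rfl, rfl⟩
      · rintro ⟨h1, h2⟩
        rw [div_add] at h1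
        rw [div_sub] at h2
        constructor
        · funext v
          have e1 := congrFun h1 v
          have e2 := congrFun h2 v
          simp only [Pi.add_apply, Pi.sub_apply] at e1 e2
          linarith
        · funext v
          have e1 := congrFun h1 v
          have e2 := congrFun h2 v
          simp only [Pi.add_apply, Pi.sub_apply] at e1 e2
          linarith
    · intro ε _ hε
      have : A ε (J + J') = 0 := by
        rw [hA]
        dsimp only
        rw [if_neg (fun h => hε h.1.symm)]
      rw [this, zero_mul]
    · intro h
      exact absurd (Finset.mem_univ _) h
  -- the support of the substituted summand lies in the image of the doubling map
  have hsupp : (Function.support fun q : (ι → ℤ) × (ι → ℤ) => ∑ ε, A ε q.1 * B ε q.2) ⊆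
      Set.range (double : (ι → ℤ) × (ι → ℤ) → (ι → ℤ) × (ι → ℤ)) := by
    rintro ⟨P, Q⟩ hq
    simp only [Function.mem_support, ne_eq] at hq
    obtain ⟨ε, -, hε⟩ := Finset.exists_ne_zero_of_sum_ne_zero hq
    have hP : parity P = ε := by
      by_contra h'
      refine hε ?_
      have : A ε P = 0 := by
        rw [hA]
        dsimp only
        rw [if_neg (fun h => h' h.1)]
      rw [this, zero_mul]
    have hQ : parity Q = ε := by
      by_contra h'
      refine hε ?_
      have : B ε Q = 0 := by
        rw [hB]
        dsimp only
        rw [if_neg (fun h => h' h.1)]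
      rw [this, mul_zero]
    exact mem_range_double (hP.trans hQ.symm)
  calc currentSum s t κ α * currentSum s t κ β
      = ∑' p : (ι → ℤ) × (ι → ℤ), (if div s t p.1 = α then weight κ p.1 else 0) *
          (if div s t p.2 = β then weight κ p.2 else 0) :=
        ennreal_tsum_mul_tsum_eq_tsum_prod _ _
    _ = ∑' p : (ι → ℤ) × (ι → ℤ),
          (fun q : (ι → ℤ) × (ι → ℤ) => ∑ ε, A ε q.1 * B ε q.2) (double p) :=
        tsum_congr fun p => hF p.1 p.2
    _ = ∑' q : (ι → ℤ) × (ι → ℤ), ∑ ε, A ε q.1 * B ε q.2 := double_injective.tsum_eq hsupp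
    _ = ∑ ε, ∑' q : (ι → ℤ) × (ι → ℤ), A ε q.1 * B ε q.2 :=
        Summable.tsum_finsetSum fun _ _ => ENNReal.summable
    _ = ∑ ε, paritySum s t κ ε (α + β) * paritySum s t κ ε (α - β) :=
        Finset.sum_congr rfl fun ε _ =>
          (ennreal_tsum_mul_tsum_eq_tsum_prod _ _).symm

/-- **Ginibre's inequality (second Griffiths inequality) for the Villain model, in current
variables.** For every finite multigraph, every stiffness field and all source functions `ρ, σ`,
`2 Z(ρ) Z(σ) ≤ Z(0) (Z(ρ + σ) + Z(ρ − σ))`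
— the current-side form of `⟨cos(ρ·θ)⟩⟨cos(σ·θ)⟩ ≤ ⟨cos(ρ·θ) cos(σ·θ)⟩` for plane rotators with
Villain bond factors (Ginibre 1970; under the duality `Z(ρ)/Z(0) = ⟨cos(ρ·θ)⟩`). Proof: by the
doubling identity the two sides are `2 ∑_ε X_ε(a)X_ε(b)` and `∑_ε (X_ε(a)² + X_ε(b)²)` with
`a = ρ + σ`, `b = ρ − σ`. [cite: Ginibre1970, main theorem and the plane-rotator example] -/
theorem ginibre (ρ σ : V → ℤ) :
    2 * (currentSum s t κ ρ * currentSum s t κ σ) ≤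
      currentSum s t κ 0 * (currentSum s t κ (ρ + σ) + currentSum s t κ (ρ - σ)) := by
  have h0 := currentSum_mul_currentSum s t κ ρ σ
  have h1 := currentSum_mul_currentSum s t κ (ρ + σ) 0
  have h2 := currentSum_mul_currentSum s t κ (ρ - σ) 0
  rw [add_zero, sub_zero] at h1 h2
  rw [mul_add, mul_comm (currentSum s t κ 0) (currentSum s t κ (ρ + σ)),
    mul_comm (currentSum s t κ 0) (currentSum s t κ (ρ - σ)), h0, h1, h2, Finset.mul_sum,
    ← Finset.sum_add_distrib]
  exact Finset.sum_le_sum fun ε _ => ennreal_two_mul_mul_le_add_mul_self _ _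

/-- **Monotonicity of the worm ratio in the graph (sub-multigraph monotonicity).** For the Villain
current model on a disjoint union of edge sets `ι₀ ⊕ ι₁` and the model on `ι₀` alone (same
vertices, same stiffnesses), `Z_{ι₀}(ρ) · Z_{ι₀⊕ι₁}(0) ≤ Z_{ι₀⊕ι₁}(ρ) · Z_{ι₀}(0)`, i.e. adding
edges can only increase `Z(ρ)/Z(0)` — for `ρ = δ_x − δ_y` the statement "the two-point function is
monotone in the volume of the system" (Aizenman–Harel–Peled–Shapiro 2021, Cor. 11.4; Ginibre
1970). Proof: `Z(ρ) = ∑_{J₁} W(J₁) Z₀(ρ − div J₁)`, `Z(0) = ∑_{J₁} W(J₁) Z₀(div J₁)`, and GKS-II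
`2 Z₀(ρ) Z₀(div J₁) ≤ Z₀(0)(Z₀(ρ + div J₁) + Z₀(ρ − div J₁))`, resummed (`J₁ ↦ −J₁` in the first
half). [cite: AizenmanHarelPeledShapiro2021, Cor. 11.4] -/
theorem currentSum_restrict_mul_le {ι₀ ι₁ : Type*} [Fintype ι₀] [Fintype ι₁] [DecidableEq ι₀]
    (s₀ t₀ : ι₀ → V) (κ₀ : ι₀ → ℝ) (s₁ t₁ : ι₁ → V) (κ₁ : ι₁ → ℝ) (ρ : V → ℤ) :
    currentSum s₀ t₀ κ₀ ρ * currentSum (Sum.elim s₀ s₁) (Sum.elim t₀ t₁) (Sum.elim κ₀ κ₁) 0 ≤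
      currentSum (Sum.elim s₀ s₁) (Sum.elim t₀ t₁) (Sum.elim κ₀ κ₁) ρ * currentSum s₀ t₀ κ₀ 0 := by
  set Z₀ := currentSum s₀ t₀ κ₀
  rw [currentSum_sum_elim, currentSum_sum_elim]
  simp only [zero_sub, currentSum_neg]
  rw [← ENNReal.mul_le_mul_iff_right (two_ne_zero) (ENNReal.ofNat_ne_top (n := 2))]
  calc 2 * (Z₀ ρ * ∑' J₁, weight κ₁ J₁ * Z₀ (div s₁ t₁ J₁))
      = ∑' J₁, weight κ₁ J₁ * (2 * (Z₀ ρ * Z₀ (div s₁ t₁ J₁))) := by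
        rw [← ENNReal.tsum_mul_left, ← ENNReal.tsum_mul_left]
        refine tsum_congr fun J₁ => ?_
        ring
    _ ≤ ∑' J₁, weight κ₁ J₁ * (Z₀ 0 * (Z₀ (ρ + div s₁ t₁ J₁) + Z₀ (ρ - div s₁ t₁ J₁))) :=
        ENNReal.tsum_le_tsum fun J₁ => mul_le_mul_right (ginibre s₀ t₀ κ₀ ρ _) _
    _ = Z₀ 0 * (∑' J₁, weight κ₁ J₁ * Z₀ (ρ + div s₁ t₁ J₁)) +
          Z₀ 0 * (∑' J₁, weight κ₁ J₁ * Z₀ (ρ - div s₁ t₁ J₁)) := by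
        rw [← ENNReal.tsum_mul_left, ← ENNReal.tsum_mul_left, ← ENNReal.tsum_add]
        refine tsum_congr fun J₁ => ?_
        ring
    _ = Z₀ 0 * (∑' J₁, weight κ₁ J₁ * Z₀ (ρ - div s₁ t₁ J₁)) +
          Z₀ 0 * (∑' J₁, weight κ₁ J₁ * Z₀ (ρ - div s₁ t₁ J₁)) := by
        congr 2
        conv_lhs => rw [← (Equiv.neg (ι₁ → ℤ)).tsum_eq]
        refine tsum_congr fun J₁ => ?_
        simp only [Equiv.neg_apply, weight_neg, div_neg, ← sub_eq_add_neg]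
    _ = 2 * ((∑' J₁, weight κ₁ J₁ * Z₀ (ρ - div s₁ t₁ J₁)) * Z₀ 0) := by ring

end Doubling

end MultigraphCurrent

/-! ### The space-time torus model is an instance; time slices -/

namespace VillainCurrentModel

open JCurrent

variable {d L M : ℕ}

/-- The **time slice** `τ` of a Villain current model on `(ℤ/L)^d × ℤ/M`: the model on
`(ℤ/L)^d × ℤ/1` whose bond `((r, 0), μ)` carries the stiffness of the bond `((r, τ), μ)` of `P`.
Its spatial bonds form the `d`-dimensional Villain model of slice `τ`; its temporal bonds are loops
(`ZMod 1` is trivial), drop out of the divergence and cancel in every ratio of current sums.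
[folklore] -/
def slice (P : VillainCurrentModel d L M) (τ : ZMod M) : VillainCurrentModel d L 1 where
  stiffness b := P.stiffness ((b.1.1, τ), b.2)
  stiffness_pos _ := P.stiffness_pos _

/-- The stiffness of a slice unfolded. [folklore] -/
@[simp] theorem slice_stiffness (P : VillainCurrentModel d L M) (τ : ZMod M) (b : Bond d L 1) :
    (P.slice τ).stiffness b = P.stiffness ((b.1.1, τ), b.2) := rfl

variable [NeZero L] [NeZero M]

/-- The torus divergence `JCurrent.div` is the multigraph divergence for the oriented bonds
`b = (s, μ) : s → s + e_μ` (tail `b.1`, head `b.1 + e_μ`). [folklore] -/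
theorem _root_.Literature.Probability.LatticeModels.JCurrent.div_eq_multigraphDiv
    (J : Config d L M) :
    JCurrent.div J =
      MultigraphCurrent.div (fun b : Bond d L M => b.1) (fun b => b.1 + unitVec b.2) J := by
  funext v
  have h1 : ∑ b : Bond d L M, (if b.1 = v then J b else 0) = ∑ μ : Dir d, J (v, μ) := by
    rw [Fintype.sum_prod_type, Finset.sum_comm]
    simp only [Finset.sum_ite_eq', Finset.mem_univ, if_true]
  have h2 : ∑ b : Bond d L M, (if b.1 + unitVec b.2 = v then J b else 0) =
      ∑ μ : Dir d, J (v - unitVec μ, μ) := by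
    rw [Fintype.sum_prod_type, Finset.sum_comm]
    refine Finset.sum_congr rfl fun μ _ => ?_
    have : ∀ s : SpaceTimeSite d L M, (s + unitVec μ = v) = (s = v - unitVec μ) := fun s =>
      propext eq_sub_iff_add_eq.symm
    simp only [this, Finset.sum_ite_eq', Finset.mem_univ, if_true]
  simp only [JCurrent.div, MultigraphCurrent.div, sub_mul, ite_mul, one_mul, zero_mul,
    Finset.sum_sub_distrib, h1, h2]


/-- **The torus model is a multigraph Villain current model**: every current sum of
`P : VillainCurrentModel d L M` is `MultigraphCurrent.currentSum` for the oriented bonds of the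
space-time torus with tail `b.1`, head `b.1 + e_{b.2}` and stiffness `P.stiffness`. [folklore] -/
theorem currentSum_eq_multigraphCurrentSum (P : VillainCurrentModel d L M)
    (ρ : SpaceTimeSite d L M → ℤ) :
    P.currentSum ρ =
      MultigraphCurrent.currentSum (fun b : Bond d L M => b.1) (fun b => b.1 + unitVec b.2)
        P.stiffness ρ := by
  unfold VillainCurrentModel.currentSum MultigraphCurrent.currentSum
  refine tsum_congr fun J => if_congr (by rw [div_eq_multigraphDiv]) rfl rfl

/-- **GKS-II for the Villain current model on the space-time torus**: for all source functions
`ρ, σ`, `2 Z(ρ) Z(σ) ≤ Z · (Z(ρ + σ) + Z(ρ − σ))`. [cite: Ginibre1970, plane-rotator example] -/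
theorem two_mul_currentSum_mul_le (P : VillainCurrentModel d L M)
    (ρ σ : SpaceTimeSite d L M → ℤ) :
    2 * (P.currentSum ρ * P.currentSum σ) ≤
      P.partitionFunction * (P.currentSum (ρ + σ) + P.currentSum (ρ - σ)) := by
  simp only [VillainCurrentModel.partitionFunction, currentSum_eq_multigraphCurrentSum]
  exact MultigraphCurrent.ginibre _ _ _ ρ σ

/-- **Slice monotonicity (GKS-II / Ginibre in current variables).** The equal-time two-point
function of a Villain current model on `(ℤ/L)^d × ℤ/M` dominates the two-point function of each of
its time slices: `(P.slice τ).twoPoint (x,0) (y,0) ≤ P.twoPoint (x,τ) (y,τ)`. Indeed the slice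
model's current sums are a constant (the free sum over its temporal loop currents) times the current
sums of the sub-multigraph of `P` made of the spatial bonds of slice `τ` (with the other vertices of
the space-time torus isolated), so this is sub-multigraph monotonicity
(`MultigraphCurrent.currentSum_restrict_mul_le`). On the rotor side: `P`'s Gibbs factor is the
slice's times the (Ginibre-cone) factors of all other bonds, and Griffiths II applies (Ginibre
1970); "monotone in the volume" (Aizenman–Harel–Peled–Shapiro 2021, Cor. 11.4).
[cite: Ginibre1970, plane-rotator example; AizenmanHarelPeledShapiro2021 Cor. 11.4] -/
theorem twoPoint_slice_le (P : VillainCurrentModel d L M) (τ : ZMod M) (x y : TorusSite d L) :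
    (P.slice τ).twoPoint (x, 0) (y, 0) ≤ P.twoPoint (x, τ) (y, τ) := by
  classical
  set P₀ := P.slice τ
  -- heads of bonds, and the embedding of the slice into the space-time torus
  let tB : Bond d L M → SpaceTimeSite d L M := fun b => b.1 + unitVec b.2
  let tB₀ : Bond d L 1 → SpaceTimeSite d L 1 := fun b => b.1 + unitVec b.2
  let φ : SpaceTimeSite d L 1 → SpaceTimeSite d L M := fun v => (v.1, τ)
  have hφ : Injective φ := fun v w h =>
    Prod.ext (congrArg Prod.fst h :) (Subsingleton.elim _ _)
  -- spatial and temporal bonds of the slice model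
  let p : Bond d L 1 → Prop := fun b => b.2.isSome
  let ssp : {b : Bond d L 1 // p b} → SpaceTimeSite d L 1 := fun b => b.1.1
  let tsp : {b : Bond d L 1 // p b} → SpaceTimeSite d L 1 := fun b => tB₀ b.1
  let κsp : {b : Bond d L 1 // p b} → ℝ := fun b => P₀.stiffness b.1
  let stm : {b : Bond d L 1 // ¬ p b} → SpaceTimeSite d L 1 := fun b => b.1.1
  let ttm : {b : Bond d L 1 // ¬ p b} → SpaceTimeSite d L 1 := fun b => tB₀ b.1
  let κtm : {b : Bond d L 1 // ¬ p b} → ℝ := fun b => P₀.stiffness b.1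
  set C : ℝ≥0∞ := ∑' J₁ : {b : Bond d L 1 // ¬ p b} → ℤ, MultigraphCurrent.weight κtm J₁
  set Zsp := MultigraphCurrent.currentSum ssp tsp κsp
  -- Step A: the slice model's current sums are `C` times the spatial current sums
  have hA : ∀ ρ₀, P₀.currentSum ρ₀ = C * Zsp ρ₀ := by
    intro ρ₀
    rw [currentSum_eq_multigraphCurrentSum,
      ← MultigraphCurrent.currentSum_comp_equiv _ _ _ (Equiv.sumCompl p)]
    have e1 : (fun b : Bond d L 1 => b.1) ∘ (Equiv.sumCompl p) = Sum.elim ssp stm := by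
      funext b; rcases b with b | b <;> rfl
    have e2 : (fun b : Bond d L 1 => b.1 + unitVec b.2) ∘ (Equiv.sumCompl p) = Sum.elim tsp ttm := by
      funext b; rcases b with b | b <;> rfl
    have e3 : P₀.stiffness ∘ (Equiv.sumCompl p) = Sum.elim κsp κtm := by
      funext b; rcases b with b | b <;> rfl
    rw [e1, e2, e3, MultigraphCurrent.currentSum_sum_elim]
    have hloop : ∀ J₁, MultigraphCurrent.div stm ttm J₁ = 0 := fun J₁ =>
      MultigraphCurrent.div_eq_zero_of_loop stm ttm (fun b => by
        have hb : b.1.2 = none := Option.not_isSome_iff_eq_none.1 b.2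
        show b.1.1 = b.1.1 + unitVec b.1.2
        rw [hb]
        exact Prod.ext (by simp [unitVec]) (Subsingleton.elim _ _)) J₁
    simp only [hloop, sub_zero]
    rw [ENNReal.tsum_mul_right]
  -- Step B: the spatial current sums, viewed inside the space-time torus
  have hB1 : MultigraphCurrent.currentSum (φ ∘ ssp) (φ ∘ tsp) κsp
      (Pi.single ((x, τ) : SpaceTimeSite d L M) 1 - Pi.single ((y, τ) : SpaceTimeSite d L M) 1) =
      Zsp (Pi.single ((x, 0) : SpaceTimeSite d L 1) 1 - Pi.single ((y, 0) : SpaceTimeSite d L 1) 1) := by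
    refine MultigraphCurrent.currentSum_comp_embedding φ hφ ssp tsp κsp (fun v => ?_) (fun w hw => ?_)
    · obtain ⟨r, τ₀⟩ := v
      obtain rfl : τ₀ = 0 := Subsingleton.elim _ _
      simp only [φ, Pi.sub_apply, Pi.single_apply, Prod.mk.injEq, and_true]
    · have hw' : w.2 ≠ τ := fun h => hw ⟨(w.1, 0), Prod.ext rfl h.symm⟩
      have hx : w ≠ (x, τ) := fun h => hw' (by rw [h])
      have hy : w ≠ (y, τ) := fun h => hw' (by rw [h])
      simp only [Pi.sub_apply, Pi.single_apply, if_neg hx, if_neg hy, sub_zero]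
  have hB0 : MultigraphCurrent.currentSum (φ ∘ ssp) (φ ∘ tsp) κsp 0 = Zsp 0 :=
    MultigraphCurrent.currentSum_comp_embedding φ hφ ssp tsp κsp (fun _ => rfl) (fun _ _ => rfl)
  -- Step C: `P` itself, with its bonds split into (spatial bonds of slice τ) ⊕ (the rest)
  let q : Bond d L M → Prop := fun b => b.1.2 = τ ∧ b.2.isSome
  let e₂ : {b : Bond d L 1 // p b} ≃ {b : Bond d L M // q b} :=
    { toFun := fun b => ⟨((b.1.1.1, τ), b.1.2), rfl, b.2⟩
      invFun := fun b => ⟨((b.1.1.1, 0), b.1.2), b.2.2⟩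
      left_inv := fun b => Subtype.ext (Prod.ext (Prod.ext rfl (Subsingleton.elim _ _)) rfl)
      right_inv := fun b => Subtype.ext (Prod.ext (Prod.ext rfl b.2.1.symm) rfl) }
  let E : {b : Bond d L 1 // p b} ⊕ {b : Bond d L M // ¬ q b} ≃ Bond d L M :=
    (Equiv.sumCongr e₂ (Equiv.refl _)).trans (Equiv.sumCompl q)
  let sr : {b : Bond d L M // ¬ q b} → SpaceTimeSite d L M := fun b => b.1.1
  let tr : {b : Bond d L M // ¬ q b} → SpaceTimeSite d L M := fun b => tB b.1
  let κr : {b : Bond d L M // ¬ q b} → ℝ := fun b => P.stiffness b.1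
  have hCfull : ∀ ρ, P.currentSum ρ = MultigraphCurrent.currentSum (Sum.elim (φ ∘ ssp) sr)
      (Sum.elim (φ ∘ tsp) tr) (Sum.elim κsp κr) ρ := by
    intro ρ
    rw [currentSum_eq_multigraphCurrentSum, ← MultigraphCurrent.currentSum_comp_equiv _ _ _ E]
    have f1 : (fun b : Bond d L M => b.1) ∘ E = Sum.elim (φ ∘ ssp) sr := by
      funext b; rcases b with b | b <;> rfl
    have f2 : (fun b : Bond d L M => b.1 + unitVec b.2) ∘ E = Sum.elim (φ ∘ tsp) tr := by
      funext b
      rcases b with b | b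
      · obtain ⟨k, hk⟩ := Option.isSome_iff_exists.1 b.2
        show ((b.1.1.1, τ) : SpaceTimeSite d L M) + unitVec b.1.2 = φ (b.1.1 + unitVec b.1.2)
        rw [hk]
        exact Prod.ext (by simp [φ, unitVec]) (by simp [φ, unitVec])
      · rfl
    have f3 : P.stiffness ∘ E = Sum.elim κsp κr := by
      funext b; rcases b with b | b <;> rfl
    rw [f1, f2, f3]
  have hmono := MultigraphCurrent.currentSum_restrict_mul_le (φ ∘ ssp) (φ ∘ tsp) κsp sr tr κr
    (Pi.single ((x, τ) : SpaceTimeSite d L M) 1 - Pi.single ((y, τ) : SpaceTimeSite d L M) 1)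
  rw [← hCfull, ← hCfull, hB1, hB0] at hmono
  -- Step D: ratios
  have hC0 : C ≠ 0 := by
    refine (lt_of_lt_of_le one_pos ?_).ne'
    refine le_trans ?_ (ENNReal.le_tsum (0 : {b : Bond d L 1 // ¬ p b} → ℤ))
    simp
  have hCtop : C ≠ ∞ := MultigraphCurrent.tsum_weight_ne_top fun b => P₀.stiffness_pos _
  have hZ0 : Zsp 0 ≠ 0 := MultigraphCurrent.currentSum_zero_ne_zero _ _ _
  have hZtop : Zsp 0 ≠ ∞ :=
    MultigraphCurrent.currentSum_ne_top _ _ _ (fun b => P₀.stiffness_pos _) _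
  rw [VillainCurrentModel.twoPoint, VillainCurrentModel.twoPoint, VillainCurrentModel.partitionFunction,
    VillainCurrentModel.partitionFunction, hA, hA, ENNReal.mul_div_mul_left _ _ hC0 hCtop]
  exact ennreal_div_le_div_of_mul_le_mul hmono hZ0 hZtop P.partitionFunction_ne_zero
    P.partitionFunction_ne_top

end VillainCurrentModel

end Literature.Probability.LatticeModels
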